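import Mathlib.LinearAlgebra.Matrix.Determinant.Basic
import Literature.NumberTheory.LFunctions.RiemannXi
import Literature.Analysis.TotalPositivity.PolyaFrequency
import HarnessLib

/-!
# Multiple positivity of the Taylor sequence of `ξ(1/2 + √z)` (Katkova 2006/07) — named facts

Trunk T-NT-LFUNC (Literature/NumberTheory/LFunctions). Vendored by the grounder for route
RiemannHypothesis/TotalPositivity (decls
`Summit.RiemannHypothesis.RiemannHypothesis.Theses.TotalPositivity.{TpThesis, Assembly,
TpOrderThree, TpAsymptoticRegime, TpConverse, TpNegativeCertificate}`).

**Dictionary.** Katkova [Katkova2006, §1 eq. (3)–(6)] writes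
`ξ₁(z) := ξ(√z + 1/2) = Σ_{k ≥ 0} b_k z^k` (`ξ` as in Titchmarsh = the tree's `Literature.NumberTheory.LFunctions.riemannXi`), an
entire function of order `1/2`, and calls a sequence `(a_k)_{k ≥ 0}` *`m`-times positive*
(`PF_m`) when all minors of order `≤ m` of the Toeplitz matrix `(a_{j-i})_{i,j ≥ 0}` (`a_k = 0`
for `k < 0`) are non-negative, *totally positive* (`PF_∞`) when all minors are [Katkova2006,
Def. 2]. The tree's GORZ coefficients satisfy `Σ γ(n) z^{2n}/n! = 8 ξ(1/2 + z)`
(`Literature.NumberTheory.LFunctions.hasSum_xiTaylorCoeff`), so the route's sequence `a_n := Literature.xiTaylorCoeff n / n!` is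
`a_n = 8 b_n`. Multiplying a sequence by the constant `8 > 0` multiplies every order-`ν` minor
by `8^ν > 0`, and transposing the Toeplitz matrix (`(a_{j-i})` vs the route's `(a_{i-j})`) permutes
the set of minors without changing their values, so `ξ₁ ∈ PF_m` is exactly the statement that all
minors of order `≤ m` of the route's lower-triangular Toeplitz matrix of `(a_n)` are `≥ 0`. The
minors are written below with the SAME inline expression as the route file (rows `r`, columns `c`
strictly increasing, entry `a_{r i - c j}` guarded by `c j ≤ r i`), and `xiToeplitzMinor_eq` proves
this equals `Literature.TotalPositivity.toeplitzMinor (fun n => xiTaylorCoeff n / n!) r c` of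
`Literature/Analysis/TotalPositivity/PolyaFrequency.lean`.

* `Literature.NumberTheory.LFunctions.katkova_rh_iff_pf` — RH `↔ (a_n)` is a Pólya frequency sequence [Katkova2006, §1,
  Thm. C and the sentence following it, arXiv p. 4: "So, the Riemann Hypothesis is equivalent to
  statement that ξ₁ ∈ PF_∞"; Thm. C = Aissen–Schoenberg–Whitney–Edrei + Hadamard].
* `Literature.NumberTheory.LFunctions.katkova_pf44` — `ξ₁ ∈ PF₄₄`: unconditionally, every Toeplitz minor of `(a_n)` of order
  `≤ 44` is `≥ 0` [Katkova2006, Thm. 1, arXiv p. 4] (proof: `ξ ≠ 0` for `1/2 < re s ≤ 1`,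
  `0 ≤ im s ≤ 14` puts all zeros of `ξ₁` in `|π - arg z| ≤ π/44`; Schoenberg's sector theorem
  (Thm. B) and Hadamard genus `0`).
* `Literature.NumberTheory.LFunctions.katkova_apf` — `ξ₁ ∈ APF_m` for every `m` [Katkova2006, Thm. 2 with Def. 3, arXiv p. 4]:
  for each `m` there is `N` such that all minors of the `m × ∞` matrix `(a_{N+j-l})_{l < m, j ≥ 0}`
  are `≥ 0`.
* `Literature.NumberTheory.LFunctions.katkova_consecutive_minors_pos` — the sharper printed intermediate statement
  [Katkova2006, §2, display following Prop. 1, arXiv p. 5]: for each `m` there is `N(m)` with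
  `det (a_{k+j-l})_{l,j < ν} > 0` for all `k ≥ N(m)`, `1 ≤ ν ≤ m`.

Nothing is asserted: the four facts are `def … : Prop`; users take `(h : Literature.RH.katkova_pf44)` etc.

## References

* O. M. Katkova, *Multiple positivity and the Riemann zeta-function*, Comput. Methods Funct.
  Theory 7 (2007) 13–31; arXiv:math/0505174. [Katkova2006]
* M. Aissen, A. Edrei, I. J. Schoenberg, A. Whitney, J. Analyse Math. 2 (1952/53) 93–109.
* S. M. Fallat, C. R. Johnson, *Totally Nonnegative Matrices*, Princeton 2011, p. 15 (the ASWE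
  theorem as printed).
* M. Griffin, K. Ono, L. Rolen, D. Zagier, PNAS 116 (2019), eq. (1) (`γ(n)`).
-/

noncomputable section

open scoped Nat

namespace Literature.NumberTheory.LFunctions

open Literature.Analysis.TotalPositivity

/-- The `(r, c)`-minor of the lower-triangular Toeplitz matrix of `a_n := γ(n)/n!`
(`γ = Literature.xiTaylorCoeff`), written exactly as in route TotalPositivity: entry `(i, j)` is
`a_{r i - c j}` if `c j ≤ r i` and `0` otherwise. [Katkova2006, Def. 2 (transposed); Karlin 1968,
Ch. 8 §1] [cite: Katkova2006, Def. 2] -/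
def xiToeplitzMinor {k : ℕ} (r c : Fin k → ℕ) : ℝ :=
  (Matrix.of fun i j : Fin k =>
      if c j ≤ r i then xiTaylorCoeff (r i - c j) / ((r i - c j)! : ℝ) else 0).det

/-- The route's guarded-`ℕ`-subtraction minor is the `toeplitzMinor` of
`Literature/Analysis/TotalPositivity/PolyaFrequency.lean` (two-sided extension by `0`, `ℤ`
indices) for the sequence `n ↦ γ(n)/n!`. [folklore] -/
theorem xiToeplitzMinor_eq {k : ℕ} (r c : Fin k → ℕ) :
    xiToeplitzMinor r c = toeplitzMinor (fun n => xiTaylorCoeff n / (n ! : ℝ)) r c := by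
  unfold xiToeplitzMinor toeplitzMinor
  congr 1
  ext i j
  simp only [Matrix.of_apply]
  split_ifs with h
  · have : ((r i : ℤ) - (c j : ℤ)) = ((r i - c j : ℕ) : ℤ) := by push_cast [h]; ring
    rw [this, seqZ_natCast]
  · rw [seqZ_of_neg]
    rw [not_le] at h
    omega

/-- `(γ(n)/n!)` is a Pólya frequency sequence (in the sense of `PolyaFrequency.lean`) iff every
route-style minor is `≥ 0`. [folklore] -/
theorem isPolyaFrequencySeq_xi_iff :
    IsPolyaFrequencySeq (fun n => xiTaylorCoeff n / (n ! : ℝ)) ↔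
      ∀ (k : ℕ) (r c : Fin k → ℕ), StrictMono r → StrictMono c → 0 ≤ xiToeplitzMinor r c := by
  simp only [IsPolyaFrequencySeq, xiToeplitzMinor_eq]

/-- NAMED FACT (**Katkova 2006, §1: Thm. C and the sentence following it** — "the Riemann
Hypothesis is equivalent to statement that `ξ₁ ∈ PF_∞`"; Thm. C: an ENTIRE `f` is in `PF_∞` iff
`f ∈ L-P⁺`, a corollary of Aissen–Schoenberg–Whitney–Edrei; and RH `⇔ ξ₁ ∈ L-P⁺`, Pólya). In the
tree's normalisation (`a_n = γ(n)/n! = 8 b_n`, see the module docstring): RH holds iff every minor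
of the lower-triangular Toeplitz matrix `(a_{i-j})` is `≥ 0`. Grounds
`Summit.RiemannHypothesis.RiemannHypothesis.Theses.TotalPositivity.Assembly` (`←`) and
`.TpConverse` (`→`); `Summit.RiemannHypothesis` is `_root_.RiemannHypothesis` by `Iff.rfl`.
Users take `(h : katkova_rh_iff_pf)`. [cite: Katkova2006, §1 Thm. C] -/
def katkova_rh_iff_pf : Prop :=
  RiemannHypothesis ↔
    ∀ (k : ℕ) (r c : Fin k → ℕ), StrictMono r → StrictMono c →
      0 ≤ (Matrix.of fun i j : Fin k =>
        if c j ≤ r i then xiTaylorCoeff (r i - c j) / ((r i - c j)! : ℝ) else 0).det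

/-- NAMED FACT (**Katkova 2006, Thm. 1**: `ξ₁ ∈ PF₄₄`, unconditionally). In the tree's
normalisation: every minor of order `k ≤ 44` of the lower-triangular Toeplitz matrix of
`a_n = γ(n)/n!` is `≥ 0`. Printed proof: `ξ(s) ≠ 0` for `1/2 < re s ≤ 1, 0 ≤ im s ≤ 14`
(Titchmarsh Ch. XV) puts the zeros `z_k` of `ξ₁` in `|π - arg z_k| ≤ π/44`; `ξ₁(0) > 0`, order
`1/2` and Hadamard give `ξ₁ = C ∏ (1 - z/z_k)`; Schoenberg's Thm. B (a polynomial `f`, `f(0) > 0`,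
zero-free in `|arg z| < πm/(m+1)` is in `PF_m`) applied to the partial products, then a locally
uniform limit. Grounds `…Theses.TotalPositivity.TpOrderThree` (instance `k = 3`) and shows
`…TpNegativeCertificate` needs `k ≥ 45`. Users take `(h : katkova_pf44)`. [cite: Katkova2006, Thm. 1] -/
def katkova_pf44 : Prop :=
  ∀ (k : ℕ), k ≤ 44 → ∀ (r c : Fin k → ℕ), StrictMono r → StrictMono c →
    0 ≤ (Matrix.of fun i j : Fin k =>
      if c j ≤ r i then xiTaylorCoeff (r i - c j) / ((r i - c j)! : ℝ) else 0).det

/-- NAMED FACT (**Katkova 2006, Thm. 2 with Def. 3**: `ξ₁ ∈ APF_m` for all `m ∈ ℕ`). Def. 3: a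
sequence `(a_k)` is *asymptotically `m`-times positive* if there is `N` such that all minors of
the `m × ∞` matrix `A_N := (a_{N+j-l})_{l = 0..m-1, j ≥ 0}` (`a_k = 0` for `k < 0`) are `≥ 0`.
In the tree's normalisation `a_n = γ(n)/n!`; a minor of `A_N` is given by rows `l` (strictly
increasing, values `< m`) and columns `j` (strictly increasing), entry `a_{N + j q - l p}` guarded
by `l p ≤ N + j q`. Nearest print to `…Theses.TotalPositivity.TpAsymptoticRegime` (which allows
arbitrary row spread and is STRONGER for `k > 44`). Users take `(h : katkova_apf)`. [cite: Katkova2006, Thm. 2] -/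
def katkova_apf : Prop :=
  ∀ m : ℕ, ∃ N : ℕ, ∀ (k : ℕ) (l j : Fin k → ℕ), StrictMono l → StrictMono j → (∀ p, l p < m) →
    0 ≤ (Matrix.of fun p q : Fin k =>
      if l p ≤ N + j q then xiTaylorCoeff (N + j q - l p) / ((N + j q - l p)! : ℝ) else 0).det

/-- NAMED FACT (**Katkova 2006, §2, the display following Prop. 1** — derived there from Prop. 1
and Lemma 2 for `f¹ = A ξ₁`, `A > 0`): for every `m` there is `N(m)` such that for all `k ≥ N(m)`
and `1 ≤ ν ≤ m` the consecutive Toeplitz minor `A_k^ν = det (a_{k+j-l})_{l,j = 0..ν-1}` is `> 0`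
(eq. (7): `a_k = 0` for `k < 0`; here `k ≥ N(m) ≥ ν - 1` can be assumed so no guard is needed —
we still guard the `ℕ`-subtraction). Positive scaling `A` does not affect signs. With Schoenberg's
Thm. D (consecutive minors `> 0` ⇒ all minors `> 0`) this yields Thm. 2. Users take
`(h : katkova_consecutive_minors_pos)`. [cite: Katkova2006, §2 Prop. 1] -/
def katkova_consecutive_minors_pos : Prop :=
  ∀ m : ℕ, ∃ N : ℕ, ∀ k : ℕ, N ≤ k → ∀ ν : ℕ, 1 ≤ ν → ν ≤ m →
    0 < (Matrix.of fun l j : Fin ν =>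
      if (l : ℕ) ≤ k + j then xiTaylorCoeff (k + j - l) / ((k + j - l)! : ℝ) else 0).det

/-! ### Sanity API -/

/-- The empty minor is `1`. [folklore] -/
theorem xiToeplitzMinor_fin_zero (r c : Fin 0 → ℕ) : xiToeplitzMinor r c = 1 := by
  simp [xiToeplitzMinor, Matrix.det_isEmpty]

/-- `katkova_pf44` yields the order-`3` statement of the route verbatim (instantiation only).
[Katkova2006, Thm. 1] [folklore] -/
theorem katkova_pf44.order_three (h : katkova_pf44) (r c : Fin 3 → ℕ) (hr : StrictMono r)
    (hc : StrictMono c) :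
    0 ≤ (Matrix.of fun i j : Fin 3 =>
      if c j ≤ r i then xiTaylorCoeff (r i - c j) / ((r i - c j)! : ℝ) else 0).det :=
  h 3 (by norm_num) r c hr hc

/-- `katkova_rh_iff_pf` restated through `IsPolyaFrequencySeq`. [Katkova2006, §1 Thm. C] [folklore] -/
theorem katkova_rh_iff_pf.iff_isPolyaFrequencySeq (h : katkova_rh_iff_pf) :
    RiemannHypothesis ↔ IsPolyaFrequencySeq (fun n => xiTaylorCoeff n / (n ! : ℝ)) := by
  rw [isPolyaFrequencySeq_xi_iff]
  exact h

end Literature.NumberTheory.LFunctions
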